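import Summits.QuantumFields.BalabanUV.Beta.GAN24.ContactBorderEntryBound

/-!
# `BalabanUV.Beta.GAN24.ContactBorderEntryBoundMf` — binder row G-an2-4 / (CONV-C), CT-ROUTE, the row owner's `gen21/BORNV-PLAN-v0.md` §4 «(V-C)», (C4)-V module (B3):
# **THE ENTRY BOUND OF THE mf-CHANNEL V CONTACT DIFFERENCE FROM LETTERS** (generic `d`) — (B2)'s script on leaf-02 g48's second socket `contact_border_mf_eq_factorised`

NOT IN PRINT; OUR BOOKKEEPING (G-an2-4 formalisation swarm → CRUX TEAM (2), leaf prover `b2b-balaban-gan24-formalise-leaf-03`, gen 55; (C4)-V typist of record per the OWNER's W17, journal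
`CLAIMS.log` l.34977).  [folklore] bookkeeping over `ContactBorderCommutator.contact_border_mf_eq_factorised`, (B2) `ContactBorderEntryBound` (the three V cell sums, the sublattice
re-indexing) and leaf-01's `ContactFaceJumpBorder.tipCommutator_eq_sum` BY NAME.  Generic `d`; every analytic input a LETTER; 0 `def`, 0 cited facts, 0 `def … : Prop`, 0 sorry; NO estimate
of Bałaban's.  HONEST FRAMING (cell contract, verbatim): «discharging `BetaPertH` makes Bałaban's UV stability UNCONDITIONAL — a real constructive-QFT result; it is NOT the continuum limit
and NOT the Clay problem.»  HONEST DEPENDENCY (verbatim): «continuum YM on T⁴ ⇐ BetaPertH ∧ nine spine estimates (0/9 proved); BetaPertH ⇐ (D1) ∧ (D4) ∧ CAP+tail; G-an2-4 gates asym, D1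
and NE2/3/4.»

## What (generic `d`, `1 ≤ Lc`, box root `ρ = toSite rr`; letters as in (B2) §2 with the COMMON multiplier leg `M` now the LEFT leg, its tent centred at its output label `x′`)
**`abs_contact_border_mf_le`**: `|push₃ M T T (reslot inr inl V_ρ) κ′u′ x′z′ (inl α)(inl β) − push₃ M B B (reslot inr inl V_ρ) κ′u′ x′z′ (inl α)(inl β)|`
`≤ (Lc^{d+1})⁻¹·((d+1)·T_b·(E₀²·Cnt))·(2·K_B·(2α_g + 2α_g·Lc·n) + (4α_g² + 8α_g²·Lc·n))·((Lc^n)^{d+1}·Zl(κ∕(4(d+1))))·e^{−(κ∕12)(‖z′−x′‖∞ + ‖u′−x′‖∞)}` — the TIP cell (gauge `λ_{βz′}`,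
dressed leg `T_{κ′u′}` split `= B_{κ′u′} + dz λ_{κ′u′}`) and the ROOT cell (gauge `λ_{κ′u′}`, undressed leg `B_{βz′}`).  With (B2): BOTH mixed channels of the V contact are bounded entry by
entry from letters.  NOT HERE: the `d = 3` letters and the unit count ((C)∕(D)).  Discharges NO letter of (CONV-C); hCv ∕ hV ∕ hB ∕ hS0-comb OPEN; NEVER «G-an2-4 closed» as (CONV-C); NOT D1,
NOT BetaPertH, NOT continuum, NOT Clay.
Unit `b2b-balaban-gan24-formalise-leaf-03` (gen 55), 2026-08-21.
-/

noncomputable section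

open Finset
open scoped BigOperators
open Literature.MathematicalPhysics.QuantumFieldTheory
open Literature.MathematicalPhysics.QuantumFieldTheory.LatticeForm (quo)
open Literature.MathematicalPhysics.QuantumFieldTheory.Balaban1983to89
open Literature.MathematicalPhysics.QuantumFieldTheory.Balaban1983to89.Beta
open B4ContourShift (supNorm supNorm_nonneg)
open ExpKernelCalculus (MKer Zl Zl_nonneg)
open AffineAveraging (Form0 Form1 Site box toSite unitVec dz)
open AveragingContours (blk off)
open AveragingContoursRooted (linAvgAt)
open AveragingHessianKernels (ell)
open AveragingHessianKernelsRooted (linCountAt vhSAt)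
open OneStepResolventKernel (Fib)
open Summit.QuantumFields.BalabanUV.Beta.GAN24.SrecLinearPartEq (reslot)
open Summit.QuantumFields.BalabanUV.Beta.GAN24.Push3 (push₃)
open Summit.QuantumFields.BalabanUV.Beta.GAN24.Push3LegTelescope (abs_le_of_env' summable_of_env')
open Summit.QuantumFields.BalabanUV.Beta.GAN24.ContactFaceJumpBorder (tipCommutator_eq_sum)
open Summit.QuantumFields.BalabanUV.Beta.GAN24.ContactBorderCommutator (contact_border_mf_eq_factorised)
open Summit.QuantumFields.BalabanUV.Beta.GAN24.ContactBorderEntryBound (tsum_sum_mul_ite_off_eq abs_sum_tsum_tip_le abs_sum_tsum_root_le abs_sum_tsum_tip_dz_le)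

namespace Summit.QuantumFields.BalabanUV.Beta.GAN24.ContactBorderEntryBoundMf

variable {d : ℕ} {Lc : ℕ} [NeZero Lc] {rr : Fin (d + 1) → ℕ} {n : ℕ} {κ αg KB CT CM Tb : ℝ}
  {T B M : Fin (d + 1) → (Fin (d + 1) → ℤ) → Fin (d + 1) → (Fin (d + 1) → ℤ) → ℝ}
  {lam : Fin (d + 1) → (Fin (d + 1) → ℤ) → (Fin (d + 1) → ℤ) → ℝ}
  {G : Fin (d + 1) → (Fin (d + 1) → ℤ) → ℕ → Site (d + 1) → ℝ}

/-- NOT IN PRINT; OUR BOOKKEEPING ([folklore]; every analytic input a LETTER).  **THE ENTRY BOUND OF THE mf-CHANNEL V CONTACT DIFFERENCE.**  Legs `T` (dressed: bounded with summable fine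
slices) and `B` (undressed: block envelope at blocking `Lc^{n+1}`) with `T − B = dz λ`, the bond gauge functions staircases with localised geometric pieces, the COMMON multiplier LEFT leg `M`
(bounded, summable fine slices) under the TENT letter `|M α x′ μ (Lc•y)| ≤ T_b·e^{−κ‖quo (Lc^n) y − x′‖∞}`.  THEN for all `κ′ u′ x′ z′ α β`, with `V_ρ = vhSAt ρ d Lc`,
`|push₃ M T T (reslot inr inl V_ρ) κ′u′ x′z′ (inl α)(inl β) − push₃ M B B (reslot inr inl V_ρ) κ′u′ x′z′ (inl α)(inl β)|`
`≤ (Lc^{d+1})⁻¹·((d+1)·T_b·(E₀²·Cnt))·(2·K_B·(2α_g + 2α_g·Lc·n) + (4α_g² + 8α_g²·Lc·n))·((Lc^n)^{d+1}·Zl(κ∕(4(d+1))))·e^{−(κ∕12)(‖z′−x′‖∞ + ‖u′−x′‖∞)}`. -/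
theorem abs_contact_border_mf_le (hLc : 1 ≤ Lc) (hrr : rr ∈ box (d + 1) Lc) (hκ : 0 < κ) (hαg : 0 ≤ αg) (hKB : 0 ≤ KB) (hTb : 0 ≤ Tb)
    (hT : ∀ μ z κ u, |T μ z κ u| ≤ CT) (hTs : ∀ μ z κ, Summable fun u => T μ z κ u)
    (hB : ∀ μ z l u, |B μ z l u| ≤ KB * Real.exp (-(κ * supNorm (quo (Lc ^ (n + 1)) u - z))))
    (hTB : T - B = fun μ z κ u => dz (lam μ z) κ u)
    (hψ : ∀ μ₀ z₀ u, lam μ₀ z₀ u = ∑ s ∈ Finset.range (n + 1), G μ₀ z₀ s (blk (Lc ^ s) u))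
    (hG : ∀ μ₀ z₀ s, s ≤ n → ∀ u, |G μ₀ z₀ s (blk (Lc ^ s) u)| ≤ αg * (Lc : ℝ) ^ s * Real.exp (-(κ * supNorm (quo (Lc ^ (n + 1)) u - z₀))))
    (hM : ∀ α x' μ x, |M α x' μ x| ≤ CM) (hMs : ∀ α x' μ, Summable fun x => M α x' μ x)
    (hMt : ∀ (α : Fin (d + 1)) (x' : Site (d + 1)) (μ : Fin (d + 1)) (y : Site (d + 1)),
      |M α x' μ ((Lc : ℤ) • y)| ≤ Tb * Real.exp (-(κ * supNorm (quo (Lc ^ n) y - x'))))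
    (κ' : Fin (d + 1)) (u' x' z' : Site (d + 1)) (α β : Fin (d + 1)) :
    |push₃ M T T (reslot Sum.inr Sum.inl (vhSAt (toSite rr) d Lc rfl)) κ' u' x' z' (Sum.inl α) (Sum.inl β)
        - push₃ M B B (reslot Sum.inr Sum.inl (vhSAt (toSite rr) d Lc rfl)) κ' u' x' z' (Sum.inl α) (Sum.inl β)|
      ≤ ((Lc : ℝ) ^ (d + 1))⁻¹ *
          ((((d : ℝ) + 1) * Tb * (Real.exp (2 * ((d : ℝ) + 1) * κ) ^ 2 *
              (((2 * Lc : ℕ) : ℝ) ^ (d + 1) * (((d + 1 : ℕ) : ℝ) * ((Lc : ℝ) ^ (d + 1) * (ell (d + 1) Lc : ℝ))))))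
            * (2 * KB * (2 * αg + 2 * αg * Lc * n) + (4 * αg ^ 2 + 2 * (4 * αg ^ 2) * Lc * n))
            * ((((Lc ^ n : ℕ) : ℝ)) ^ (d + 1) * Zl (d + 1) (κ / (4 * ((d : ℝ) + 1))))
            * Real.exp (-(κ / 12) * (supNorm (z' - x') + supNorm (u' - x')))) := by
  -- the leg class of `B` and the socket
  have hLn1 : 1 ≤ Lc ^ (n + 1) := Nat.one_le_pow _ _ hLc
  have hBb : ∀ μ z l u, |B μ z l u| ≤ KB := abs_le_of_env' hκ.le hB
  have hBs : ∀ μ z l, Summable fun u => B μ z l u := summable_of_env' hLn1 hκ hB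
  rw [contact_border_mf_eq_factorised hLc hrr hM hMs hT hTs hBb hBs hT hBb hTB hTB κ' u' x' z' α β]
  -- sublattice re-indexing of the two cells
  rw [tsum_sum_mul_ite_off_eq hLc (fun a x => M α x' a x) (fun a y x => ((Lc : ℝ) ^ (d + 1))⁻¹ *
      (linAvgAt (toSite rr) (fun κ u => lam β z' (u + unitVec κ) * T κ' u' κ u) Lc a y
        - lam β z' (x + toSite rr + (Lc : ℤ) • unitVec a) * linAvgAt (toSite rr) (T κ' u') Lc a y)),
    tsum_sum_mul_ite_off_eq hLc (fun a x => M α x' a x) (fun a y x => ((Lc : ℝ) ^ (d + 1))⁻¹ *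
      (lam κ' u' (x + toSite rr) * linAvgAt (toSite rr) (B β z') Lc a y
        - linAvgAt (toSite rr) (fun b z => lam κ' u' z * B β z' b z) Lc a y))]
  -- the split of the TIP cell's dressed leg `T κ′ u′ = B κ′ u′ + dz (λ κ′ u′)`
  have eT : ∀ b z, T κ' u' b z = B κ' u' b z + dz (lam κ' u') b z := fun b z => by
    have h := congrFun (congrFun (congrFun (congrFun hTB κ') u') b) z
    simp only [Pi.sub_apply] at h
    linarith
  have hsplit : ∀ a y,
      linAvgAt (toSite rr) (fun b z => lam β z' (z + unitVec b) * T κ' u' b z) Lc a y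
          - lam β z' ((Lc : ℤ) • y + toSite rr + (Lc : ℤ) • unitVec a) * linAvgAt (toSite rr) (T κ' u') Lc a y
        = (linAvgAt (toSite rr) (fun b z => lam β z' (z + unitVec b) * B κ' u' b z) Lc a y
            - lam β z' ((Lc : ℤ) • y + toSite rr + (Lc : ℤ) • unitVec a) * linAvgAt (toSite rr) (B κ' u') Lc a y)
          + (linAvgAt (toSite rr) (fun b z => lam β z' (z + unitVec b) * dz (lam κ' u') b z) Lc a y
            - lam β z' ((Lc : ℤ) • y + toSite rr + (Lc : ℤ) • unitVec a) * linAvgAt (toSite rr) (dz (lam κ' u')) Lc a y) := by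
    intro a y
    rw [tipCommutator_eq_sum hrr, tipCommutator_eq_sum hrr, tipCommutator_eq_sum hrr (lam β z') (dz (lam κ' u')), ← Finset.sum_add_distrib]
    refine Finset.sum_congr rfl fun x _ => ?_
    rw [← Finset.sum_add_distrib]
    refine Finset.sum_congr rfl fun b _ => ?_
    rw [eT b x]; ring
  -- the three cells (brackets `b a y := M α x′ a (Lc•y)`, tent label `x′`)
  obtain ⟨hs1, hb1⟩ := abs_sum_tsum_tip_le (b := fun a y => M α x' a ((Lc : ℤ) • y)) (xg := z') (xl := u') (u' := x')
    hLc hrr hκ hαg hKB hTb (hψ β z') (hG β z') (fun b z => hB κ' u' b z) (hMt α x')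
  obtain ⟨hs2, hb2⟩ := abs_sum_tsum_tip_dz_le (b := fun a y => M α x' a ((Lc : ℤ) • y)) (xg := z') (xl := u') (u' := x')
    hLc hrr hκ hαg hTb (hψ β z') (hψ κ' u') (hG β z') (hG κ' u') (hMt α x')
  obtain ⟨hs3, hb3⟩ := abs_sum_tsum_root_le (b := fun a y => M α x' a ((Lc : ℤ) • y)) (xg := u') (xl := z') (u' := x')
    hLc hrr hκ hαg hKB hTb (hψ κ' u') (hG κ' u') (fun b z => hB β z' b z) (hMt α x')
  rw [add_comm (supNorm (u' - x')) (supNorm (z' - x'))] at hb3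
  -- regroup the first cell: constant out, split, exchange
  set c₀ : ℝ := ((Lc : ℝ) ^ (d + 1))⁻¹ with hc₀
  have e1 : (∑' y : Site (d + 1), ∑ a, M α x' a ((Lc : ℤ) • y) * (c₀ *
        (linAvgAt (toSite rr) (fun κ u => lam β z' (u + unitVec κ) * T κ' u' κ u) Lc a y
          - lam β z' ((Lc : ℤ) • y + toSite rr + (Lc : ℤ) • unitVec a) * linAvgAt (toSite rr) (T κ' u') Lc a y)))
      = c₀ * ((∑ a, ∑' y : Site (d + 1), M α x' a ((Lc : ℤ) • y) *
          (linAvgAt (toSite rr) (fun b z => lam β z' (z + unitVec b) * B κ' u' b z) Lc a y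
            - lam β z' ((Lc : ℤ) • y + toSite rr + (Lc : ℤ) • unitVec a) * linAvgAt (toSite rr) (B κ' u') Lc a y))
        + ∑ a, ∑' y : Site (d + 1), M α x' a ((Lc : ℤ) • y) *
          (linAvgAt (toSite rr) (fun b z => lam β z' (z + unitVec b) * dz (lam κ' u') b z) Lc a y
            - lam β z' ((Lc : ℤ) • y + toSite rr + (Lc : ℤ) • unitVec a) * linAvgAt (toSite rr) (dz (lam κ' u')) Lc a y)) := by
    have step1 : ∀ y : Site (d + 1), (∑ a, M α x' a ((Lc : ℤ) • y) * (c₀ *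
        (linAvgAt (toSite rr) (fun κ u => lam β z' (u + unitVec κ) * T κ' u' κ u) Lc a y
          - lam β z' ((Lc : ℤ) • y + toSite rr + (Lc : ℤ) • unitVec a) * linAvgAt (toSite rr) (T κ' u') Lc a y)))
        = c₀ * ∑ a, (M α x' a ((Lc : ℤ) • y) *
            (linAvgAt (toSite rr) (fun b z => lam β z' (z + unitVec b) * B κ' u' b z) Lc a y
              - lam β z' ((Lc : ℤ) • y + toSite rr + (Lc : ℤ) • unitVec a) * linAvgAt (toSite rr) (B κ' u') Lc a y)
          + M α x' a ((Lc : ℤ) • y) *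
            (linAvgAt (toSite rr) (fun b z => lam β z' (z + unitVec b) * dz (lam κ' u') b z) Lc a y
              - lam β z' ((Lc : ℤ) • y + toSite rr + (Lc : ℤ) • unitVec a) * linAvgAt (toSite rr) (dz (lam κ' u')) Lc a y)) := by
      intro y
      rw [Finset.mul_sum]
      refine Finset.sum_congr rfl fun a _ => ?_
      rw [hsplit a y]; ring
    rw [tsum_congr step1, tsum_mul_left, Summable.tsum_finsetSum (fun a _ => (hs1 a).add (hs2 a))]
    congr 1
    rw [← Finset.sum_add_distrib]
    exact Finset.sum_congr rfl fun a _ => (hs1 a).tsum_add (hs2 a)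
  have e2 : (∑' y : Site (d + 1), ∑ a, M α x' a ((Lc : ℤ) • y) * (c₀ *
        (lam κ' u' ((Lc : ℤ) • y + toSite rr) * linAvgAt (toSite rr) (B β z') Lc a y
          - linAvgAt (toSite rr) (fun b z => lam κ' u' z * B β z' b z) Lc a y)))
      = c₀ * ∑ a, ∑' y : Site (d + 1), M α x' a ((Lc : ℤ) • y) *
          (lam κ' u' ((Lc : ℤ) • y + toSite rr) * linAvgAt (toSite rr) (B β z') Lc a y
            - linAvgAt (toSite rr) (fun b z => lam κ' u' z * B β z' b z) Lc a y) := by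
    rw [← Summable.tsum_finsetSum (fun a _ => hs3 a), ← tsum_mul_left]
    refine tsum_congr fun y => ?_
    rw [Finset.mul_sum]
    exact Finset.sum_congr rfl fun a _ => by ring
  rw [e1, e2, ← mul_add]
  have hc0 : 0 ≤ c₀ := by positivity
  rw [abs_mul, abs_of_nonneg hc0]
  refine (mul_le_mul_of_nonneg_left ((abs_add_le _ _).trans (add_le_add ((abs_add_le _ _).trans (add_le_add hb1 hb2)) hb3)) hc0).trans
    (le_of_eq ?_)
  ring

end Summit.QuantumFields.BalabanUV.Beta.GAN24.ContactBorderEntryBoundMf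

end
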